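import Summits.ABC.IUTFork.Joshi.ATS2TestInterface
import Summits.ABC.IUTFork.Joshi.TestGenuineJoshiNormalisedResidual
import Summits.ABC.IUTFork.Cor312PilotIdelesPrWitness
import HarnessLib

/-!
# Joshi [J-II]/[J-IIp] vs `S`, TEST part 4c — census row Y-10 DECIDED AT THE GENUINE DATA, Joshi's q-normalisation:
# the q-pilot's Kummer image is none of the Θ-pilot's at label `1` (pin-free core), hence `¬ Y` for every admissible reading

Proof-only Test file of the abc-iut cell, block E, D-0079 R-J «JOSHI Y-DISCHARGE CENSUS» row **Y-10** (table of record
`HOME/plan/E/R-J/Y-CENSUS.tsv`; seat abc-iut-E-t2, gen 8; rung LADDER-ABC:A2.RESCUE.J); companion of `Joshi/TestATS2QSideCensus.lean`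
(§1–§2: `Y` LOCATED as the container-free region identification `∀ j v_ℚ, ρ qK = ρ Ψ_n` = sub-cell B3's H_J21-1, and its exact relation
to `S`). A `Joshi/Test*` file (E-PLAN R14): OUR side imported BY NAME. **No side is taken** on [IUTchIII] Cor. 3.12, on Joshi's claims
(arXiv:2111.04890 [J-II] / 2303.01662v3 [J-IIp] / 2401.13508v4 [J-III], unrefereed) or on Mochizuki's report on them; typed ≠ proved ≠
endorsed; a statement about OUR typed objects at one instantiation. `S := Cor312Vol.PilotKummerIndRelated S P ρ qK`;
`Y := Joshi.ATS2.PilotReading.QSide` (p428531). PROOF-ONLY: 0 definitions, no `Prop` fact, no `sorry`, standard axioms.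

## RESULTS (kernel) — `Thm311.Real.settingPrVolSharp` with Θ-ideles `t` REALISING `P_Θ` and the q-idele realising `−ℓ⋆²·P_q`
(abc-iut-E-t4's `htqJ`, [J-III] (9.9.4) p.121 with the q-parameter pinned at the LAST label; INHABITED by the last Θ-idele,
`realisesJoshiQ_lastTheta` p434945)

* **`qRegion_ne_thetaRegion_genuine_joshiNormalised` — PIN-FREE CORE.** At label `1` over any prime `p` under a bad place `v₀ ∈ S`
  the q-pilot's Kummer image is NOT the `m`-th Kummer image of the Θ-pilot, for any `m`: log-volumes `ℓ⋆²·A_p` vs `A_p` (E-t4's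
  `thetaValuationScaling_joshiNormalised`: `logvol(Θ_m) = (1/ℓ⋆)²·qLocal` at label `1`; `qLocal_settingPrVolSharp_inr_of_realising`),
  `A_p < 0` (`qSum_neg`), `ℓ⋆ ≥ 2`. `ρ`-free, column-free, pin-free (cf. census row Y-26: the pins' (hρ)-clause is uninhabited at
  these carriers for IUT-shaped `F`, abc-iut-E-t44 p446117 — the core does not use it).
* **`no_qSide_genuine_joshiNormalised` — `¬ Y`, reading form**: for EVERY lattice situation over the genuine situation, EVERY `ρ`, `qK`
  reading at the one packet `(1, p)` the q-pilot's Kummer datum as the setting's q-image and the line-`n` Θ-monoid as some Kummer image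
  of the Θ-pilot, and EVERY δ1∧δ2∧(J)-reading over ANY container: `¬ δ.QSide ρ qK`.
* `no_qSide_genuine_of_pinned_joshiNormalised` — the PINNED phrasing (via E-t4's `not_pilotKummerIndRelated_joshiNormalised_of_pinned`),
  with the Y-26 caveat.
* `exists_ideles_no_regionId_joshiNormalised` — NON-VACUITY: under `2ℓ ∣ ord_v(q_v)` on `S`, Θ-ideles realising `P_Θ` exist
  (c312-7) and with the q-idele := the last Θ-idele the core fires at every bad place.
So under EITHER q-normalisation (sibling `Joshi/TestATS2QSideCensusGenuine.lean`: print's `htq`, label `2`) `Y` fails at the genuine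
data for every admissible reading — what differs between the normalisations is Joshi's J (p433340 vs p434945), not `Y`.
[claim: Joshi2024ATS3, status: disputed] [claim: Joshi2021ATS2, status: disputed] [claim: Mochizuki2012, status: disputed]
[cite: ScholzeStix2018, §2.2 pp. 9–10] [cite: DupuyHilado2025, §3.3, §3.9, Thm. 3.10.1]
-/

noncomputable section

open Set

namespace Summit.ABC.IUTFork.Joshi.ATS2

open Function NumberField IsDedekindDomain
open Thm311 Thm311.Real Cor312 Cor312Vol Literature.IUT.LogThetaLattice Literature.IUT.LogVolume Literature.IUT.HodgeTheaters

section Genuine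

variable {F : Type} [Field F] [NumberField F] (X : PilotData F) {logv : PadicLogs F} (hlog : LogvAnalytic logv)
  (M : Type) [Field M] [NumberField M]
  (archPk : ∀ (j : (thetaIndex X).Label) (vQ : (thetaIndex X).VQ), Set ((logShellsDH X logv).Packet j vQ))
  (archSub : ∀ (j : (thetaIndex X).Label) (v : (thetaIndex X).V),
    Set ((logShellsDH X logv).Packet j ((thetaIndex X).over v)))
  (Ψ : ℤ → ∀ v : (thetaIndex X).V, v ∈ (thetaIndex X).Vbad → Set ((logShellsDH X logv).StarPacket v))
  (act : ℤ → ∀ v : (thetaIndex X).V, v ∈ (thetaIndex X).Vbad →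
    (logShellsDH X logv).StarPacket v → Module.End ℚ ((logShellsDH X logv).StarPacket v))
  (Mmod : ℤ → ∀ j : (thetaIndex X).LabelStar, Set ((logShellsDH X logv).GlobalPacket j.1))
  (region : ℤ → ∀ j : (thetaIndex X).LabelStar, FinDivisor M → ∀ vQ : (thetaIndex X).VQ,
    Set ((logShellsDH X logv).Packet j.1 vQ))
  (frobAdm : ℤ → ℤ → ∀ (j : (thetaIndex X).Label) (vQ : (thetaIndex X).VQ),
    Set ((logShellsDH X logv).Packet j vQ) → Prop)
  (frobLogvol : ℤ → ℤ → ∀ (j : (thetaIndex X).Label) (vQ : (thetaIndex X).VQ),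
    Set ((logShellsDH X logv).Packet j vQ) → ℝ)
  (frobΨ : ℤ → ℤ → ∀ v : (thetaIndex X).V, v ∈ (thetaIndex X).Vbad → Set ((logShellsDH X logv).StarPacket v))
  (frobMmod : ℤ → ℤ → ∀ j : (thetaIndex X).LabelStar, Set ((logShellsDH X logv).GlobalPacket j.1))
  (unitImage : ℤ → ℤ → ℕ → ∀ (j : (thetaIndex X).Label) (vQ : (thetaIndex X).VQ),
    Set ((logShellsDH X logv).Packet j vQ))
  (ballImage : ℤ → ℤ → ∀ (j : (thetaIndex X).Label) (vQ : (thetaIndex X).VQ),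
    Set ((logShellsDH X logv).Packet j vQ))
  (thetaDiv : ℤ → ℤ → LgpDivisor M (thetaIndex X).lstar)
  (n : ℤ) {HT : Type} {LogLink : HT → HT → Type} {IsFull : ∀ {s t : HT}, LogLink s t → Prop}
  (lat : LGPGaussianLogThetaLattice LogLink IsFull)
  {Frd : Type} {IsoF : Frd → Frd → Type} {Ob : Frd → Type} {realify : Frd → Frd} {Strip : Type}
  {IsoS : Strip → Strip → Type} {Mv : ∀ v : (thetaIndex X).V, v ∈ (thetaIndex X).Vbad → Type}
  [∀ v h, Monoid (Mv v h)]
  (sig : GlobalLGPFrobenioidSignature (thetaIndex X).lstar (thetaIndex X).V (· ∈ (thetaIndex X).Vbad)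
    Frd IsoF Ob realify Strip IsoS Mv)
  (split : SplittingMonoids Mv) {ObΔ : Type} {N : ∀ v : (thetaIndex X).V, v ∈ (thetaIndex X).Vbad → Type}
  [∀ v h, Monoid (N v h)] (qData : QPilotData ObΔ N)
  (t : ∀ (pp : Nat.Primes) (_ : Fin X.lstar) (x : (thetaIndex X).Fibre (.inr pp)),
    haveI : Fact (pp : ℕ).Prime := ⟨pp.2⟩; kOf X pp.1 x)
  (tq : ∀ (pp : Nat.Primes) (x : (thetaIndex X).Fibre (.inr pp)), haveI : Fact (pp : ℕ).Prime := ⟨pp.2⟩; kOf X pp.1 x)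
  (ρ : (∀ v : (thetaIndex X).V, v ∈ (thetaIndex X).Vbad → Set ((logShellsDH X logv).StarPacket v)) →
    ∀ (j : (thetaIndex X).Label) (vQ : (thetaIndex X).VQ), Set ((logShellsDH X logv).Packet j vQ))
  (qK : ∀ v : (thetaIndex X).V, v ∈ (thetaIndex X).Vbad → Set ((logShellsDH X logv).StarPacket v))

/-! ## The pin-free core at label `1`, the reading form, the pinned form -/

/-- **PIN-FREE CORE (Joshi's normalisation).** At `settingPrVolSharp` with Θ-ideles realising `P_Θ` and the q-idele realising
`−ℓ⋆²·P_q` (abc-iut-E-t4's `htqJ`, inhabited by the last Θ-idele, `realisesJoshiQ_lastTheta`), the q-pilot's Kummer image at label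
`1` over the prime under a bad place is NOT any Kummer image of the Θ-pilot: volumes `ℓ⋆²·A_p` vs `A_p` (E-t4's
`thetaValuationScaling_joshiNormalised` gives `logvol(Θ_m) = (1/ℓ⋆)²·qLocal` at label `1`), `A_p < 0`, `ℓ⋆ ≥ 2`. `ρ`-free, pin-free.
[claim: Joshi2024ATS3, status: disputed] [cite: DupuyHilado2025, §3.3, §3.9, Thm. 3.10.1] -/
theorem qRegion_ne_thetaRegion_genuine_joshiNormalised (ht0 : ∀ pp i x, t pp i x ≠ 0)
    (ht : ∀ (pp : Nat.Primes) (i : Fin X.lstar) (x : (thetaIndex X).Fibre (.inr pp)),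
      haveI : Fact (pp : ℕ).Prime := ⟨pp.2⟩
      Real.log ‖t pp i x‖ = -(X.thetaPilot i (placeOf X pp.1 x)) * logNorm F (placeOf X pp.1 x) /
        localDegree F (placeOf X pp.1 x))
    (htq0 : ∀ pp x, tq pp x ≠ 0)
    (htq1 : ∀ (pp : Nat.Primes) (x : (thetaIndex X).Fibre (.inr pp)),
      haveI : Fact (pp : ℕ).Prime := ⟨pp.2⟩; placeOf X pp.1 x ∉ X.S → ‖tq pp x‖ = 1)
    (htqJ : ∀ (pp : Nat.Primes) (x : (thetaIndex X).Fibre (.inr pp)),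
      haveI : Fact (pp : ℕ).Prime := ⟨pp.2⟩
      Real.log ‖tq pp x‖ = -(((X.lstar : ℝ) ^ 2) * X.qPilot (placeOf X pp.1 x)) * logNorm F (placeOf X pp.1 x) /
        localDegree F (placeOf X pp.1 x))
    {v₀ : HeightOneSpectrum (𝓞 F)} (hv₀ : v₀ ∈ X.S) (pp : Nat.Primes)
    (hp : haveI : Fact (pp : ℕ).Prime := ⟨pp.2⟩; v₀ ∈ placesOver F pp) (m : ℤ) :
    (settingPrVolSharp X hlog M archPk archSub Ψ act Mmod region n lat sig split qData tq t htq0 htq1).qRegion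
        (Setting.labelSucc ⟨0, lt_of_lt_of_le two_pos X.two_le_lstar⟩) (.inr pp) ≠
      (settingPrVolSharp X hlog M archPk archSub Ψ act Mmod region n lat sig split qData tq t htq0 htq1).thetaRegion m
        (Setting.labelSucc ⟨0, lt_of_lt_of_le two_pos X.two_le_lstar⟩) (.inr pp) := by
  haveI : Fact (pp : ℕ).Prime := ⟨pp.2⟩
  intro h
  -- Joshi's J at label `1`: some Kummer image has volume `(1/ℓ⋆)²·qLocal`; all Kummer images coincide (no `m`-drift)
  obtain ⟨m₁, hm₁⟩ := thetaValuationScaling_joshiNormalised X hlog M archPk archSub Ψ act Mmod region n lat sig split qData t tq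
    ht0 ht htq0 htq1 htqJ ⟨0, lt_of_lt_of_le two_pos X.two_le_lstar⟩ (.inr pp)
  have hmm : (settingPrVolSharp X hlog M archPk archSub Ψ act Mmod region n lat sig split qData tq t htq0 htq1).thetaRegion m
        (Setting.labelSucc ⟨0, lt_of_lt_of_le two_pos X.two_le_lstar⟩) (.inr pp) =
      (settingPrVolSharp X hlog M archPk archSub Ψ act Mmod region n lat sig split qData tq t htq0 htq1).thetaRegion m₁
        (Setting.labelSucc ⟨0, lt_of_lt_of_le two_pos X.two_le_lstar⟩) (.inr pp) := by
    unfold settingPrVolSharp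
    rw [thetaRegion_sharp_Pr, thetaRegion_sharp_Pr]
  -- the q-side closed form `qLocal = ℓ⋆²·A_p`
  have hq := qLocal_settingPrVolSharp_inr_of_realising X hlog M archPk archSub Ψ act Mmod region n lat sig split qData t tq
    htq0 htq1 (fun v => -(((X.lstar : ℝ) ^ 2) * X.qPilot v)) htqJ (Setting.labelSucc ⟨0, lt_of_lt_of_le two_pos X.two_le_lstar⟩) pp
  -- `qLocal` is the log-volume of the q-image; substitute the assumed identity of regions
  have hdef : (settingPrVolSharp X hlog M archPk archSub Ψ act Mmod region n lat sig split qData tq t htq0 htq1).qLocal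
        (Setting.labelSucc ⟨0, lt_of_lt_of_le two_pos X.two_le_lstar⟩) (.inr pp) =
      ((situationPrVol X hlog M archPk archSub Ψ act Mmod region).D n).logvol _ (.inr pp)
        ((settingPrVolSharp X hlog M archPk archSub Ψ act Mmod region n lat sig split qData tq t htq0 htq1).thetaRegion m₁
          (Setting.labelSucc ⟨0, lt_of_lt_of_le two_pos X.two_le_lstar⟩) (.inr pp)) := by
    rw [← hmm, ← h]
    rfl
  replace hdef := hdef.trans hm₁
  -- `qLocal = w·qLocal` with `w = (1/ℓ⋆)² < 1` forces `qLocal = 0`, but `qLocal = ℓ⋆²·A_p < 0`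
  have hw : scalingWeight (thetaIndex X) ⟨0, lt_of_lt_of_le two_pos X.two_le_lstar⟩ = 1 / ((X.lstar : ℝ) ^ 2) := by
    unfold scalingWeight
    rw [show (((⟨0, lt_of_lt_of_le two_pos X.two_le_lstar⟩ : Fin (thetaIndex X).lstar) : ℕ) : ℝ) = 0 from by simp,
      show ((thetaIndex X).lstar : ℝ) = (X.lstar : ℝ) from rfl]
    ring
  have key : (∑ v ∈ placesOver F pp, -(((X.lstar : ℝ) ^ 2) * X.qPilot v) * logNorm F v) / Module.finrank ℚ F =
      ((X.lstar : ℝ) ^ 2) * ((∑ v ∈ placesOver F pp, -(X.qPilot v) * logNorm F v) / Module.finrank ℚ F) := by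
    rw [mul_div_assoc', Finset.mul_sum]
    congr 1
    refine Finset.sum_congr rfl fun v _ => ?_
    ring
  rw [hw, hq, key] at hdef
  have hA := qSum_neg X hv₀ pp hp
  have hl : (2 : ℝ) ≤ (X.lstar : ℝ) := by exact_mod_cast X.two_le_lstar
  have hl0 : (0 : ℝ) < (X.lstar : ℝ) ^ 2 := by positivity
  -- `ℓ⋆²·A = (1/ℓ⋆²)·(ℓ⋆²·A) = A`
  have hAA : ((X.lstar : ℝ) ^ 2) *
        ((∑ v ∈ placesOver F pp, -(X.qPilot v) * logNorm F v) / Module.finrank ℚ F) =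
      (∑ v ∈ placesOver F pp, -(X.qPilot v) * logNorm F v) / Module.finrank ℚ F := by
    rw [hdef]
    field_simp
  have hcoef : ((X.lstar : ℝ) ^ 2 - 1) *
      ((∑ v ∈ placesOver F pp, -(X.qPilot v) * logNorm F v) / Module.finrank ℚ F) = 0 := by
    linear_combination hAA
  rcases mul_eq_zero.mp hcoef with h1 | h1
  · nlinarith
  · exact absurd h1 hA.ne

/-- **`¬ Y` AT THE GENUINE DATA (Joshi's normalisation), reading form** — as `no_qSide_genuine_printNormalised`, at the packet
`(1, p(v₀))`. [claim: Joshi2024ATS3, status: disputed] [claim: Joshi2021ATS2, status: disputed] -/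
theorem no_qSide_genuine_joshiNormalised (ht0 : ∀ pp i x, t pp i x ≠ 0)
    (ht : ∀ (pp : Nat.Primes) (i : Fin X.lstar) (x : (thetaIndex X).Fibre (.inr pp)),
      haveI : Fact (pp : ℕ).Prime := ⟨pp.2⟩
      Real.log ‖t pp i x‖ = -(X.thetaPilot i (placeOf X pp.1 x)) * logNorm F (placeOf X pp.1 x) /
        localDegree F (placeOf X pp.1 x))
    (htq0 : ∀ pp x, tq pp x ≠ 0)
    (htq1 : ∀ (pp : Nat.Primes) (x : (thetaIndex X).Fibre (.inr pp)),
      haveI : Fact (pp : ℕ).Prime := ⟨pp.2⟩; placeOf X pp.1 x ∉ X.S → ‖tq pp x‖ = 1)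
    (htqJ : ∀ (pp : Nat.Primes) (x : (thetaIndex X).Fibre (.inr pp)),
      haveI : Fact (pp : ℕ).Prime := ⟨pp.2⟩
      Real.log ‖tq pp x‖ = -(((X.lstar : ℝ) ^ 2) * X.qPilot (placeOf X pp.1 x)) * logNorm F (placeOf X pp.1 x) /
        localDegree F (placeOf X pp.1 x))
    {v₀ : HeightOneSpectrum (𝓞 F)} (hv₀ : v₀ ∈ X.S) (pp : Nat.Primes)
    (hp : haveI : Fact (pp : ℕ).Prime := ⟨pp.2⟩; v₀ ∈ placesOver F pp) (col : ℤ → Column (logShellsDH X logv))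
    (hq : ρ qK (Setting.labelSucc ⟨0, lt_of_lt_of_le two_pos X.two_le_lstar⟩) (.inr pp) =
      (settingPrVolSharp X hlog M archPk archSub Ψ act Mmod region n lat sig split qData tq t htq0 htq1).qRegion
        (Setting.labelSucc ⟨0, lt_of_lt_of_le two_pos X.two_le_lstar⟩) (.inr pp))
    (hθ : ∃ m : ℤ, ρ (Ψ n) (Setting.labelSucc ⟨0, lt_of_lt_of_le two_pos X.two_le_lstar⟩) (.inr pp) =
      (settingPrVolSharp X hlog M archPk archSub Ψ act Mmod region n lat sig split qData tq t htq0 htq1).thetaRegion m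
        (Setting.labelSucc ⟨0, lt_of_lt_of_le two_pos X.two_le_lstar⟩) (.inr pp))
    {B : Type} (δ : PilotReading (LatticeSituation.mk (situationPrVol X hlog M archPk archSub Ψ act Mmod region) col) B)
    (h1 : δ.SizeDetermines)
    (h2 : δ.ThetaSide (settingPrVolSharp X hlog M archPk archSub Ψ act Mmod region n lat sig split qData tq t htq0 htq1) ρ)
    (hJ : δ.ThetaPilotAppears) : ¬ δ.QSide ρ qK := by
  intro hY
  obtain ⟨m, hm⟩ := hθ
  have hid := δ.qRegion_eq_thetaRegion_of_reading
    (settingPrVolSharp X hlog M archPk archSub Ψ act Mmod region n lat sig split qData tq t htq0 htq1) ρ qK h1 h2 hJ hY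
    (Setting.labelSucc ⟨0, lt_of_lt_of_le two_pos X.two_le_lstar⟩) (.inr pp)
  have hΨ : ((LatticeSituation.mk (situationPrVol X hlog M archPk archSub Ψ act Mmod region) col).D
      (settingPrVolSharp X hlog M archPk archSub Ψ act Mmod region n lat sig split qData tq t htq0 htq1).n).Ψ = Ψ n := rfl
  rw [hΨ, hq, hm] at hid
  exact qRegion_ne_thetaRegion_genuine_joshiNormalised X hlog M archPk archSub Ψ act Mmod region n lat sig split qData t tq
    ht0 ht htq0 htq1 htqJ hv₀ pp hp m hid

/-- **The PINNED phrasing (Joshi's normalisation)**, through abc-iut-E-t4's `not_pilotKummerIndRelated_joshiNormalised_of_pinned`;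
same Y-26 caveat as for the print normalisation. [claim: Joshi2024ATS3, status: disputed] [claim: Mochizuki2012, status: disputed] -/
theorem no_qSide_genuine_of_pinned_joshiNormalised (ht0 : ∀ pp i x, t pp i x ≠ 0)
    (ht : ∀ (pp : Nat.Primes) (i : Fin X.lstar) (x : (thetaIndex X).Fibre (.inr pp)),
      haveI : Fact (pp : ℕ).Prime := ⟨pp.2⟩
      Real.log ‖t pp i x‖ = -(X.thetaPilot i (placeOf X pp.1 x)) * logNorm F (placeOf X pp.1 x) /
        localDegree F (placeOf X pp.1 x))
    (htq0 : ∀ pp x, tq pp x ≠ 0)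
    (htq1 : ∀ (pp : Nat.Primes) (x : (thetaIndex X).Fibre (.inr pp)),
      haveI : Fact (pp : ℕ).Prime := ⟨pp.2⟩; placeOf X pp.1 x ∉ X.S → ‖tq pp x‖ = 1)
    (htqJ : ∀ (pp : Nat.Primes) (x : (thetaIndex X).Fibre (.inr pp)),
      haveI : Fact (pp : ℕ).Prime := ⟨pp.2⟩
      Real.log ‖tq pp x‖ = -(((X.lstar : ℝ) ^ 2) * X.qPilot (placeOf X pp.1 x)) * logNorm F (placeOf X pp.1 x) /
        localDegree F (placeOf X pp.1 x))
    (hKumB : ((LatticeSituation.ofShells (logShellsDH X logv) M archPk archSub (summandPiecesPr X hlog).Adm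
        (summandPiecesPr X hlog).logvol Ψ act Mmod region frobAdm frobLogvol frobΨ frobMmod unitImage ballImage thetaDiv).col
          n).KummerB
      ((LatticeSituation.ofShells (logShellsDH X logv) M archPk archSub (summandPiecesPr X hlog).Adm
        (summandPiecesPr X hlog).logvol Ψ act Mmod region frobAdm frobLogvol frobΨ frobMmod unitImage ballImage thetaDiv).D n))
    (hpin : Cor312Vol.PinnedRegions
      (LatticeSituation.ofShells (logShellsDH X logv) M archPk archSub (summandPiecesPr X hlog).Adm
        (summandPiecesPr X hlog).logvol Ψ act Mmod region frobAdm frobLogvol frobΨ frobMmod unitImage ballImage thetaDiv)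
      (settingPrVolSharp X hlog M archPk archSub Ψ act Mmod region n lat sig split qData tq t htq0 htq1) ρ qK)
    {B : Type}
    (δ : PilotReading (LatticeSituation.ofShells (logShellsDH X logv) M archPk archSub (summandPiecesPr X hlog).Adm
        (summandPiecesPr X hlog).logvol Ψ act Mmod region frobAdm frobLogvol frobΨ frobMmod unitImage ballImage thetaDiv) B)
    (h1 : δ.SizeDetermines)
    (h2 : δ.ThetaSide (settingPrVolSharp X hlog M archPk archSub Ψ act Mmod region n lat sig split qData tq t htq0 htq1) ρ)
    (hJ : δ.ThetaPilotAppears) : ¬ δ.QSide ρ qK :=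
  δ.not_qSide_of_not_pilotKummerIndRelated _ _ _
    (not_pilotKummerIndRelated_joshiNormalised_of_pinned X hlog M archPk archSub Ψ act Mmod region frobAdm frobLogvol frobΨ
      frobMmod unitImage ballImage thetaDiv n lat sig split qData t tq ρ qK ht0 ht htq0 htq1 htqJ hKumB hpin)
    h1 h2 hJ


/-! ## Non-vacuity: realising Θ-ideles exist; with the q-idele := the last Θ-idele the core fires -/

/-- **NON-VACUITY**: if `2ℓ ∣ ord_v(q_v)` on `S` (abc-iut-c312-7 `exists_ideles_settingPrVolSharp`) there are Θ-ideles realising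
`P_Θ`; taking for q-idele the LAST Θ-idele (Joshi's normalisation, E-t4 `realisesJoshiQ_lastTheta`), at EVERY bad place and every prime
under it the q-pilot's Kummer image at label `1` is none of the Θ-pilot's Kummer images. [claim: Joshi2024ATS3, status: disputed]
[cite: DupuyHilado2025, §3.3–§3.4] -/
theorem exists_ideles_no_regionId_joshiNormalised (hdiv : ∀ v ∈ X.S, (2 * X.l : ℤ) ∣ X.ordq v) :
    ∃ (t : ∀ (pp : Nat.Primes) (_ : Fin X.lstar) (x : (thetaIndex X).Fibre (.inr pp)),
          haveI : Fact (pp : ℕ).Prime := ⟨pp.2⟩; kOf X pp.1 x)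
      (tq : ∀ (pp : Nat.Primes) (x : (thetaIndex X).Fibre (.inr pp)), haveI : Fact (pp : ℕ).Prime := ⟨pp.2⟩; kOf X pp.1 x)
      (htq0 : ∀ pp x, tq pp x ≠ 0)
      (htq1 : ∀ (pp : Nat.Primes) (x : (thetaIndex X).Fibre (.inr pp)),
          haveI : Fact (pp : ℕ).Prime := ⟨pp.2⟩; placeOf X pp.1 x ∉ X.S → ‖tq pp x‖ = 1),
      (∀ (pp : Nat.Primes) (x : (thetaIndex X).Fibre (.inr pp)),
        haveI : Fact (pp : ℕ).Prime := ⟨pp.2⟩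
        Real.log ‖tq pp x‖ = -(((X.lstar : ℝ) ^ 2) * X.qPilot (placeOf X pp.1 x)) * logNorm F (placeOf X pp.1 x) /
          localDegree F (placeOf X pp.1 x)) ∧
      ∀ v₀ ∈ X.S, ∀ (pp : Nat.Primes), (haveI : Fact (pp : ℕ).Prime := ⟨pp.2⟩; v₀ ∈ placesOver F pp) → ∀ m : ℤ,
        (settingPrVolSharp X hlog M archPk archSub Ψ act Mmod region n lat sig split qData tq t htq0 htq1).qRegion
            (Setting.labelSucc ⟨0, lt_of_lt_of_le two_pos X.two_le_lstar⟩) (.inr pp) ≠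
          (settingPrVolSharp X hlog M archPk archSub Ψ act Mmod region n lat sig split qData tq t htq0 htq1).thetaRegion m
            (Setting.labelSucc ⟨0, lt_of_lt_of_le two_pos X.two_le_lstar⟩) (.inr pp) := by
  obtain ⟨t, tq, ht0, ht, -⟩ :=
    exists_ideles_settingPrVolSharp X hlog M archPk archSub Ψ act Mmod region n lat sig split qData hdiv
  have ht1 : ∀ (pp : Nat.Primes) (i : Fin X.lstar) (x : (thetaIndex X).Fibre (.inr pp)),
      haveI : Fact (pp : ℕ).Prime := ⟨pp.2⟩; placeOf X pp.1 x ∉ X.S → ‖t pp i x‖ = 1 :=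
    fun pp i x hx => norm_eq_one_of_realises X t ht0 ht pp i x hx
  -- Joshi's q-idele: the last Θ-idele
  let iL : Fin X.lstar := ⟨X.lstar - 1, Nat.sub_lt (lt_of_lt_of_le two_pos X.two_le_lstar) one_pos⟩
  exact ⟨t, fun pp x => t pp iL x, fun pp x => ht0 pp iL x, fun pp x hx => ht1 pp iL x hx,
    fun pp x => realisesJoshiQ_lastTheta X t ht pp x,
    fun v₀ hv₀ pp hp m => qRegion_ne_thetaRegion_genuine_joshiNormalised X hlog M archPk archSub Ψ act Mmod region n lat sig
      split qData t _ ht0 ht _ _ (fun pp x => realisesJoshiQ_lastTheta X t ht pp x) hv₀ pp hp m⟩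

end Genuine

end Summit.ABC.IUTFork.Joshi.ATS2

end
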